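import Literature.MathematicalPhysics.QuantumFieldTheory.OSDistributionSpace
import HarnessLib

/-!
# Spatial translations on the OS Hilbert space and the cluster property in vector form

Osterwalder–Schrader I (CMP 31 (1973)), §4.1, eq. (4.5): "extension of `U_s(a) v(f) = v(f_{(0,a)})`
by continuity leads to a unitary representation `U_s(a)` in `ℋ` of the three dimensional
translation group (translations in space directions)"; and §4.4, eqs. (4.29)–(4.30): the cluster
property E4 "in vector notation", `lim_{λ→∞} (w(f), U_s(λa) w(g)) = (w(f), Ω)(Ω, w(g))` for
`f, g ∈ 𝒮₊`, which "by continuity … remains true if we replace `w(f)` and `w(g)` by arbitrary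
vectors in `ℋ`".

For the distributional OS Hilbert space `OSHilbert 𝔖 hE2` of `OSDistributionSpace`:

* `spaceShiftGen`, `OSSpace.spaceShiftOp a`: spatial translation (`a⁰ = 0`) of the generators,
  an isometry of the pre-Hilbert space by E1 (`inner_spaceShiftOp_spaceShiftOp`), a group action
  fixing the vacuum; `OSSpace.spaceShiftH a`: its extension to an isometry of `ℋ`
  (`norm_spaceShiftH`, `spaceShiftH_add`, `spaceShiftH_vacuum`);
* `OSSpace.tendsto_inner_spaceShiftH` (**E4 in vector form, (4.30)**): for every nonzero spatial
  `a` and all `φ, ψ ∈ ℋ`, `⟪φ, U_s(ta) ψ⟫ → ⟪φ, Ω⟫ ⟪Ω, ψ⟫` as `t → ∞` — from E4 on generators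
  (`tendsto_genPairing_spaceShiftGen`), sesquilinearity, and density plus `‖U_s(a)‖ ≤ 1`.

## References
* K. Osterwalder, R. Schrader, Axioms for Euclidean Green's functions, CMP 31 (1973), §4.1
  eq. (4.5); §4.4 eqs. (4.29)–(4.30).
-/

noncomputable section

open Filter Topology ComplexConjugate
open scoped InnerProductSpace SchwartzMap ComplexOrder

namespace Literature.MathematicalPhysics.QuantumFieldTheory

variable {d : ℕ} [NeZero d]

/-! ## Spatial vectors and positive-time test functions -/

/-- Scalar multiples of a spatial vector are spatial. [folklore] -/
theorem smul_apply_zero_eq_zero {a : EuclideanSpace ℝ (Fin d)} (ha : a 0 = 0) (t : ℝ) :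
    (t • a) 0 = 0 := by
  simp [ha]

/-- The time reflection fixes spatial vectors. [folklore] -/
theorem timeReflection_of_apply_zero {a : EuclideanSpace ℝ (Fin d)} (ha : a 0 = 0) :
    QuantumLattice.timeReflection d a = a := by
  ext i
  rw [QuantumLattice.timeReflection_apply]
  split_ifs with hi
  · subst hi; simp [ha]
  · rfl

/-- Spatial translation preserves positive-time test functions. [folklore] -/
theorem _root_.Literature.MathematicalPhysics.QuantumLattice.IsPositiveTimeMulti.translateMulti_of_apply_zero {n : ℕ}
    {F : 𝓢((Fin n → EuclideanSpace ℝ (Fin d)), ℂ)} (hF : QuantumLattice.IsPositiveTimeMulti F)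
    {a : EuclideanSpace ℝ (Fin d)} (ha : a 0 = 0) : QuantumLattice.IsPositiveTimeMulti (QuantumLattice.translateMulti a F) := by
  intro x hx
  have hx' : x ∈ tsupport (fun y : Fin n → EuclideanSpace ℝ (Fin d) => F (fun i => y i - a)) := by
    have : (QuantumLattice.translateMulti a F : (Fin n → EuclideanSpace ℝ (Fin d)) → ℂ) =
        fun y => F (fun i => y i - a) := funext fun y => QuantumLattice.translateMulti_apply _ F y
    rwa [this] at hx
  have hcont : Continuous fun y : Fin n → EuclideanSpace ℝ (Fin d) => fun i => y i - a := by
    fun_prop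
  have h := hF (tsupport_comp_subset_preimage (F : (Fin n → EuclideanSpace ℝ (Fin d)) → ℂ) hcont hx')
  intro i
  have hi : 0 < (x i - a : EuclideanSpace ℝ (Fin d)) 0 := h i
  rw [PiLp.sub_apply, ha, sub_zero] at hi
  exact hi

section SchwingerFamily
open Literature.MathematicalPhysics.QuantumLattice (SchwingerFamily)
open Literature.MathematicalPhysics.QuantumLattice.SchwingerFamily

variable (𝔖 : SchwingerFamily (EuclideanSpace ℝ (Fin d)))

/-! ## Spatial translation of generators -/

/-- **Spatial translation of a generator**: `(n, F) ↦ (n, F(· − a))` for a spatial vector `a`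
(`a⁰ = 0`) (Osterwalder–Schrader I (1973), (4.5), `f_{(0,a)}`). [cite: OsterwalderSchraderCMP1973, §4.1 eq. (4.5)] -/
def _root_.Literature.MathematicalPhysics.QuantumLattice.SchwingerFamily.spaceShiftGen (a : EuclideanSpace ℝ (Fin d)) (ha : a 0 = 0) (p : PosGen d) : PosGen d :=
  ⟨p.1, ⟨QuantumLattice.translateMulti a p.2.1, p.2.2.translateMulti_of_apply_zero ha⟩⟩

/-- Translation by `0`. [folklore] -/
theorem _root_.Literature.MathematicalPhysics.QuantumLattice.SchwingerFamily.spaceShiftGen_zero (p : PosGen d) : spaceShiftGen 0 rfl p = p := by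
  rcases p with ⟨n, F, hF⟩
  exact Sigma.ext rfl (heq_of_eq (Subtype.ext (by simp [spaceShiftGen, QuantumLattice.translateMulti_zero])))

/-- Translations compose. [folklore] -/
theorem _root_.Literature.MathematicalPhysics.QuantumLattice.SchwingerFamily.spaceShiftGen_add {a b : EuclideanSpace ℝ (Fin d)} (ha : a 0 = 0) (hb : b 0 = 0) (p : PosGen d) :
    spaceShiftGen (a + b) (by rw [PiLp.add_apply, ha, hb, add_zero]) p =
      spaceShiftGen a ha (spaceShiftGen b hb p) :=
  Sigma.ext rfl (heq_of_eq (Subtype.ext (by simp [spaceShiftGen, QuantumLattice.translateMulti_translateMulti])))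

/-- Proof-irrelevance in the spatiality witness (for rewriting the vector). [folklore] -/
theorem _root_.Literature.MathematicalPhysics.QuantumLattice.SchwingerFamily.spaceShiftGen_congr {a b : EuclideanSpace ℝ (Fin d)} (ha : a 0 = 0) (hb : b 0 = 0) (h : a = b) :
    spaceShiftGen a ha = spaceShiftGen b hb := by
  subst h; rfl

/-- **Spatial translation is isometric for the OS form** (E1):
`𝔖(Θ(F_a)* ⊗ G_a) = 𝔖(ΘF* ⊗ G)` — `Θ(F_a)* = (ΘF*)_{θa} = (ΘF*)_a` for spatial `a`, and joint
translation invariance (Osterwalder–Schrader I (1973), (4.5): `U_s(a)` is unitary). [cite: OsterwalderSchraderCMP1973, §4.1 eq. (4.5)] -/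
theorem _root_.Literature.MathematicalPhysics.QuantumLattice.SchwingerFamily.genPairing_spaceShiftGen (hE1 : 𝔖.IsEuclideanCovariant) {a : EuclideanSpace ℝ (Fin d)}
    (ha : a 0 = 0) (p q : PosGen d) :
    genPairing 𝔖 (spaceShiftGen a ha p) (spaceShiftGen a ha q) = genPairing 𝔖 p q := by
  change 𝔖 (p.1 + q.1) (SchwartzMap.appendTensor (QuantumLattice.osAdjoint (QuantumLattice.translateMulti a p.2.1)) (QuantumLattice.translateMulti a q.2.1)) =
    𝔖 (p.1 + q.1) (SchwartzMap.appendTensor (QuantumLattice.osAdjoint p.2.1) q.2.1)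
  rw [osAdjoint_translateMulti, timeReflection_of_apply_zero ha, ← QuantumLattice.translateMulti_appendTensor,
    hE1.translateMulti]

/-- Moving a spatial translation from the left to the right slot with a sign:
`𝔖(Θ(F_a)* ⊗ G) = 𝔖(ΘF* ⊗ G_{−a})`. [folklore] -/
theorem _root_.Literature.MathematicalPhysics.QuantumLattice.SchwingerFamily.genPairing_spaceShiftGen_left (hE1 : 𝔖.IsEuclideanCovariant) {a : EuclideanSpace ℝ (Fin d)}
    (ha : a 0 = 0) (p q : PosGen d) :
    genPairing 𝔖 (spaceShiftGen a ha p) q =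
      genPairing 𝔖 p (spaceShiftGen (-a) (by rw [PiLp.neg_apply, ha, neg_zero]) q) := by
  have h := genPairing_spaceShiftGen 𝔖 hE1 (a := -a) (by rw [PiLp.neg_apply, ha, neg_zero])
    (spaceShiftGen a ha p) q
  rw [← spaceShiftGen_add, spaceShiftGen_congr _ rfl (neg_add_cancel a), spaceShiftGen_zero] at h
  exact h.symm

/-! ## The two vacuum pairings -/

/-- `⟪δ_{(n,F)}, δ_Ω⟫ = 𝔖ₙ(ΘF*)`: pairing with the vacuum generator on the right. (`n + 0 = n`
definitionally, and `H ⊗ 1 = H`.) [folklore] -/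
theorem _root_.Literature.MathematicalPhysics.QuantumLattice.SchwingerFamily.genPairing_vacGen_right (p : PosGen d) : genPairing 𝔖 p (OSSpace.vacGen d) = 𝔖 p.1 (QuantumLattice.osAdjoint p.2.1) := by
  change 𝔖 (p.1 + 0) (SchwartzMap.appendTensor (QuantumLattice.osAdjoint p.2.1) (OSSpace.vacGen d).2.1) = _
  have h : SchwartzMap.appendTensor (QuantumLattice.osAdjoint p.2.1) (OSSpace.vacGen d).2.1 = QuantumLattice.osAdjoint p.2.1 := by
    ext x
    rw [SchwartzMap.appendTensor_apply]
    simp only [OSSpace.vacGen]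
    erw [SchwartzMap.constOfSubsingleton_apply (D := Fin 0 → EuclideanSpace ℝ (Fin d)) (1 : ℂ)]
    rw [mul_one]
    rfl
  exact congrArg (fun H => 𝔖 p.1 H) h

omit [NeZero d] in
/-- Reindexing along `m = k`: a Schwinger function does not see a cast of the index type. [folklore] -/
theorem _root_.Literature.MathematicalPhysics.QuantumLattice.SchwingerFamily.apply_eq_smul_of_forall_eq_cast {m k : ℕ} (e : m = k)
    (H : 𝓢((Fin k → EuclideanSpace ℝ (Fin d)), ℂ)) (G : 𝓢((Fin m → EuclideanSpace ℝ (Fin d)), ℂ))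
    (c : ℂ) (hH : ∀ x, H x = c * G (fun j => x (Fin.cast e j))) : 𝔖 k H = c * 𝔖 m G := by
  subst e
  have : H = c • G := by
    ext x
    rw [hH x, smul_apply, smul_eq_mul]
    rfl
  rw [this, map_smul, smul_eq_mul]

/-- `⟪δ_Ω, δ_{(m,G)}⟫ = 𝔖ₘ(G)`: pairing with the vacuum generator on the left (`Θ1* = 1`, and the
reindexing `0 + m = m`). [folklore] -/
theorem _root_.Literature.MathematicalPhysics.QuantumLattice.SchwingerFamily.genPairing_vacGen_left (q : PosGen d) : genPairing 𝔖 (OSSpace.vacGen d) q = 𝔖 q.1 q.2.1 := by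
  change 𝔖 (0 + q.1) (SchwartzMap.appendTensor (QuantumLattice.osAdjoint (OSSpace.vacGen d).2.1) q.2.1) = _
  rw [← one_mul (𝔖 q.1 q.2.1)]
  refine apply_eq_smul_of_forall_eq_cast 𝔖 (Nat.zero_add q.1).symm _ _ 1 fun x => ?_
  rw [SchwartzMap.appendTensor_apply, QuantumLattice.osAdjoint_apply]
  simp only [OSSpace.vacGen]
  erw [SchwartzMap.constOfSubsingleton_apply (D := Fin 0 → EuclideanSpace ℝ (Fin d)) (1 : ℂ)]
  rw [map_one]
  congr 1
  congr 1
  funext j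
  rw [Function.comp_apply, Fin.natAdd_zero]

/-- **E4 on generators**: `⟪δ_p, δ_{q translated by ta}⟫ → ⟪δ_p, δ_Ω⟫ ⟪δ_Ω, δ_q⟫` as `t → ∞`
for a nonzero spatial `a` (Osterwalder–Schrader I (1973), §4.4 (4.29)). [cite: OsterwalderSchraderCMP1973, §4.4 eq. (4.29)] -/
theorem _root_.Literature.MathematicalPhysics.QuantumLattice.SchwingerFamily.tendsto_genPairing_spaceShiftGen (hE4 : 𝔖.HasClusterProperty) {a : EuclideanSpace ℝ (Fin d)}
    (ha : a 0 = 0) (ha' : a ≠ 0) (p q : PosGen d) :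
    Tendsto (fun t : ℝ => genPairing 𝔖 p (spaceShiftGen (t • a) (smul_apply_zero_eq_zero ha t) q))
      atTop (𝓝 (genPairing 𝔖 p (OSSpace.vacGen d) * genPairing 𝔖 (OSSpace.vacGen d) q)) := by
  have h := hE4 p.1 q.1 p.2.1 q.2.1 p.2.2 q.2.2 a ha ha'
    (fun t => SchwartzMap.appendTensor (QuantumLattice.osAdjoint p.2.1) (QuantumLattice.translateMulti (t • a) q.2.1))
    (fun t x => by rw [SchwartzMap.appendTensor_apply])
  rw [genPairing_vacGen_right, genPairing_vacGen_left]
  have h2 := h.add_const (𝔖 p.1 (QuantumLattice.osAdjoint p.2.1) * 𝔖 q.1 q.2.1)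
  rw [zero_add] at h2
  refine h2.congr fun t => ?_
  simp only [sub_add_cancel]
  rfl

section OSSpace
open Literature.MathematicalPhysics.QuantumLattice.SchwingerFamily (OSSpace)
open Literature.MathematicalPhysics.QuantumLattice.SchwingerFamily.OSSpace

variable {𝔖} {hE2 : 𝔖.IsOSReflectionPositive}

/-! ## Spatial translations on the pre-Hilbert space -/

variable (𝔖 hE2) in
/-- **The spatial translation operator `U_s(a)` on the pre-Hilbert space**, generatorwise
(Osterwalder–Schrader I (1973), (4.5)). [cite: OsterwalderSchraderCMP1973, §4.1 eq. (4.5)] -/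
def _root_.Literature.MathematicalPhysics.QuantumLattice.SchwingerFamily.OSSpace.spaceShiftOp (a : EuclideanSpace ℝ (Fin d)) (ha : a 0 = 0) : OSSpace 𝔖 hE2 →ₗ[ℂ] OSSpace 𝔖 hE2 :=
  (of 𝔖 hE2).toLinearMap ∘ₗ Finsupp.lmapDomain ℂ ℂ (spaceShiftGen a ha) ∘ₗ (of 𝔖 hE2).symm.toLinearMap

/-- `U_s(a)` relabels the generators. [folklore] -/
theorem _root_.Literature.MathematicalPhysics.QuantumLattice.SchwingerFamily.OSSpace.spaceShiftOp_of {a : EuclideanSpace ℝ (Fin d)} (ha : a 0 = 0) (v : PosGen d →₀ ℂ) :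
    spaceShiftOp 𝔖 hE2 a ha (of 𝔖 hE2 v) = of 𝔖 hE2 (Finsupp.mapDomain (spaceShiftGen a ha) v) := by
  simp only [spaceShiftOp, LinearMap.comp_apply, LinearEquiv.coe_toLinearMap,
    LinearEquiv.symm_apply_apply, Finsupp.lmapDomain_apply]

/-- `U_s(a) δ_p = δ_{p_a}`. [folklore] -/
theorem _root_.Literature.MathematicalPhysics.QuantumLattice.SchwingerFamily.OSSpace.spaceShiftOp_δ {a : EuclideanSpace ℝ (Fin d)} (ha : a 0 = 0) (p : PosGen d) :
    spaceShiftOp 𝔖 hE2 a ha (δ 𝔖 hE2 p) = δ 𝔖 hE2 (spaceShiftGen a ha p) := by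
  rw [δ, spaceShiftOp_of, Finsupp.mapDomain_single, δ]

/-- Proof-irrelevance / rewriting of the vector. [folklore] -/
theorem _root_.Literature.MathematicalPhysics.QuantumLattice.SchwingerFamily.OSSpace.spaceShiftOp_congr {a b : EuclideanSpace ℝ (Fin d)} (ha : a 0 = 0) (hb : b 0 = 0) (h : a = b) :
    spaceShiftOp 𝔖 hE2 a ha = spaceShiftOp 𝔖 hE2 b hb := by
  subst h; rfl

/-- `U_s(0) = 1`. [folklore] -/
theorem _root_.Literature.MathematicalPhysics.QuantumLattice.SchwingerFamily.OSSpace.spaceShiftOp_zero : spaceShiftOp 𝔖 hE2 0 rfl = LinearMap.id := by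
  refine LinearMap.ext fun v => ?_
  rw [← of_symm_eq v, spaceShiftOp_of, LinearMap.id_apply]
  congr 1
  have : (spaceShiftGen 0 rfl : PosGen d → PosGen d) = id := funext spaceShiftGen_zero
  rw [this, Finsupp.mapDomain_id]

/-- **Group law** `U_s(a + b) = U_s(a) U_s(b)`. [folklore] -/
theorem _root_.Literature.MathematicalPhysics.QuantumLattice.SchwingerFamily.OSSpace.spaceShiftOp_add {a b : EuclideanSpace ℝ (Fin d)} (ha : a 0 = 0) (hb : b 0 = 0) :
    spaceShiftOp 𝔖 hE2 (a + b) (by rw [PiLp.add_apply, ha, hb, add_zero]) =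
      spaceShiftOp 𝔖 hE2 a ha ∘ₗ spaceShiftOp 𝔖 hE2 b hb := by
  refine LinearMap.ext fun v => ?_
  rw [← of_symm_eq v]
  simp only [LinearMap.comp_apply, spaceShiftOp_of, ← Finsupp.mapDomain_comp]
  congr 2
  funext p
  exact spaceShiftGen_add ha hb p

/-- **`U_s(a)` preserves inner products** (E1). [cite: OsterwalderSchraderCMP1973, §4.1 eq. (4.5)] -/
theorem _root_.Literature.MathematicalPhysics.QuantumLattice.SchwingerFamily.OSSpace.inner_spaceShiftOp_spaceShiftOp (hE1 : 𝔖.IsEuclideanCovariant) {a : EuclideanSpace ℝ (Fin d)}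
    (ha : a 0 = 0) (v w : OSSpace 𝔖 hE2) :
    ⟪spaceShiftOp 𝔖 hE2 a ha v, spaceShiftOp 𝔖 hE2 a ha w⟫_ℂ = ⟪v, w⟫_ℂ := by
  rw [← of_symm_eq v, ← of_symm_eq w]
  set v' := (of 𝔖 hE2).symm v
  set w' := (of 𝔖 hE2).symm w
  rw [spaceShiftOp_of, spaceShiftOp_of, inner_def, inner_def]
  simp only [LinearEquiv.symm_apply_apply]
  rw [osFormFree_mapDomain]
  conv_rhs => rw [← (Finsupp.mapDomain_id : Finsupp.mapDomain id v' = v'),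
    ← (Finsupp.mapDomain_id : Finsupp.mapDomain id w' = w'), osFormFree_mapDomain]
  refine Finset.sum_congr rfl fun p _ => Finset.sum_congr rfl fun q _ => ?_
  rw [id, id, genPairing_spaceShiftGen 𝔖 hE1 ha]

/-- `‖U_s(a) v‖ = ‖v‖`. [folklore] -/
theorem _root_.Literature.MathematicalPhysics.QuantumLattice.SchwingerFamily.OSSpace.norm_spaceShiftOp (hE1 : 𝔖.IsEuclideanCovariant) {a : EuclideanSpace ℝ (Fin d)} (ha : a 0 = 0)
    (v : OSSpace 𝔖 hE2) : ‖spaceShiftOp 𝔖 hE2 a ha v‖ = ‖v‖ := by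
  rw [@norm_eq_sqrt_re_inner ℂ, inner_spaceShiftOp_spaceShiftOp hE1 ha, ← @norm_eq_sqrt_re_inner ℂ]

/-- Moving `U_s(a)` across the inner product: `⟪U_s(a) v, w⟫ = ⟪v, U_s(−a) w⟫`. [folklore] -/
theorem _root_.Literature.MathematicalPhysics.QuantumLattice.SchwingerFamily.OSSpace.inner_spaceShiftOp_left (hE1 : 𝔖.IsEuclideanCovariant) {a : EuclideanSpace ℝ (Fin d)}
    (ha : a 0 = 0) (v w : OSSpace 𝔖 hE2) :
    ⟪spaceShiftOp 𝔖 hE2 a ha v, w⟫_ℂ =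
      ⟪v, spaceShiftOp 𝔖 hE2 (-a) (by rw [PiLp.neg_apply, ha, neg_zero]) w⟫_ℂ := by
  have hna : (-a) 0 = 0 := by rw [PiLp.neg_apply, ha, neg_zero]
  have h := inner_spaceShiftOp_spaceShiftOp (hE2 := hE2) hE1 hna (spaceShiftOp 𝔖 hE2 a ha v) w
  rw [← LinearMap.comp_apply, ← spaceShiftOp_add hna ha,
    spaceShiftOp_congr _ rfl (neg_add_cancel a), spaceShiftOp_zero, LinearMap.id_apply] at h
  exact h.symm

/-- `U_s(a)` fixes the vacuum generator. [folklore] -/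
theorem _root_.Literature.MathematicalPhysics.QuantumLattice.SchwingerFamily.OSSpace.spaceShiftGen_vacGen {a : EuclideanSpace ℝ (Fin d)} (ha : a 0 = 0) :
    spaceShiftGen a ha (vacGen d) = vacGen d := by
  refine Sigma.ext rfl (heq_of_eq (Subtype.ext ?_))
  ext x
  simp only [vacGen, spaceShiftGen]
  erw [QuantumLattice.translateMulti_apply, SchwartzMap.constOfSubsingleton_apply (D := Fin 0 → EuclideanSpace ℝ (Fin d)) (1 : ℂ)]

/-- `U_s(a) δ_Ω = δ_Ω`. [folklore] -/
theorem _root_.Literature.MathematicalPhysics.QuantumLattice.SchwingerFamily.OSSpace.spaceShiftOp_δ_vacGen {a : EuclideanSpace ℝ (Fin d)} (ha : a 0 = 0) :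
    spaceShiftOp 𝔖 hE2 a ha (δ 𝔖 hE2 (vacGen d)) = δ 𝔖 hE2 (vacGen d) := by
  rw [spaceShiftOp_δ, spaceShiftGen_vacGen]

/-! ## Spatial translations on the Hilbert space -/

variable (hE2) in
/-- **The spatial translation `U_s(a)` on the OS Hilbert space** (Osterwalder–Schrader I (1973),
(4.5): "extension … by continuity leads to a unitary representation `U_s(a)` in `ℋ`"):
`LinearMap.extendOfNorm` of `ι ∘ U_s(a)` from the dense pre-Hilbert space (a junk value unless
the operator is bounded, which holds under E1). [cite: OsterwalderSchraderCMP1973, §4.1 eq. (4.5)] -/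
def _root_.Literature.MathematicalPhysics.QuantumLattice.SchwingerFamily.OSSpace.spaceShiftH (a : EuclideanSpace ℝ (Fin d)) (ha : a 0 = 0) : OSHilbert 𝔖 hE2 →L[ℂ] OSHilbert 𝔖 hE2 :=
  ((ι 𝔖 hE2).toLinearMap ∘ₗ spaceShiftOp 𝔖 hE2 a ha).extendOfNorm (ι 𝔖 hE2).toLinearMap

/-- `U_s(a) [v] = [U_s(a) v]`. [folklore] -/
theorem _root_.Literature.MathematicalPhysics.QuantumLattice.SchwingerFamily.OSSpace.spaceShiftH_ι (hE1 : 𝔖.IsEuclideanCovariant) {a : EuclideanSpace ℝ (Fin d)} (ha : a 0 = 0)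
    (v : OSSpace 𝔖 hE2) : spaceShiftH hE2 a ha (ι 𝔖 hE2 v) = ι 𝔖 hE2 (spaceShiftOp 𝔖 hE2 a ha v) :=
  LinearMap.extendOfNorm_eq denseRange_ι ⟨1, fun x => by
    simp [norm_spaceShiftOp (hE2 := hE2) hE1 ha x]⟩ v

/-- Rewriting the vector. [folklore] -/
theorem _root_.Literature.MathematicalPhysics.QuantumLattice.SchwingerFamily.OSSpace.spaceShiftH_congr {a b : EuclideanSpace ℝ (Fin d)} (ha : a 0 = 0) (hb : b 0 = 0) (h : a = b) :
    spaceShiftH hE2 a ha = spaceShiftH hE2 b hb := by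
  subst h; rfl

/-- **`U_s(a)` is an isometry of `ℋ`**. [cite: OsterwalderSchraderCMP1973, §4.1 eq. (4.5)] -/
theorem _root_.Literature.MathematicalPhysics.QuantumLattice.SchwingerFamily.OSSpace.norm_spaceShiftH (hE1 : 𝔖.IsEuclideanCovariant) {a : EuclideanSpace ℝ (Fin d)} (ha : a 0 = 0)
    (ψ : OSHilbert 𝔖 hE2) : ‖spaceShiftH hE2 a ha ψ‖ = ‖ψ‖ := by
  refine denseRange_ι.induction_on ψ
    (isClosed_eq ((spaceShiftH hE2 a ha).continuous.norm) continuous_norm) fun v => ?_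
  rw [spaceShiftH_ι hE1 ha, norm_ι, norm_ι, norm_spaceShiftOp hE1 ha]

/-- `U_s(0) = 1`. [folklore] -/
theorem _root_.Literature.MathematicalPhysics.QuantumLattice.SchwingerFamily.OSSpace.spaceShiftH_zero_apply (hE1 : 𝔖.IsEuclideanCovariant) (ψ : OSHilbert 𝔖 hE2) :
    spaceShiftH hE2 0 rfl ψ = ψ := by
  refine denseRange_ι.induction_on ψ (isClosed_eq (spaceShiftH hE2 0 rfl).continuous continuous_id)
    fun v => ?_
  rw [spaceShiftH_ι hE1 rfl, spaceShiftOp_zero, LinearMap.id_apply]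

/-- **Group law** `U_s(a + b) = U_s(a) U_s(b)` on `ℋ`. [folklore] -/
theorem _root_.Literature.MathematicalPhysics.QuantumLattice.SchwingerFamily.OSSpace.spaceShiftH_add_apply (hE1 : 𝔖.IsEuclideanCovariant) {a b : EuclideanSpace ℝ (Fin d)}
    (ha : a 0 = 0) (hb : b 0 = 0) (ψ : OSHilbert 𝔖 hE2) :
    spaceShiftH hE2 (a + b) (by rw [PiLp.add_apply, ha, hb, add_zero]) ψ =
      spaceShiftH hE2 a ha (spaceShiftH hE2 b hb ψ) := by
  refine denseRange_ι.induction_on ψ ?_ fun v => ?_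
  · exact isClosed_eq (spaceShiftH hE2 (a + b) _).continuous
      ((spaceShiftH hE2 a ha).continuous.comp (spaceShiftH hE2 b hb).continuous)
  · rw [spaceShiftH_ι hE1, spaceShiftH_ι hE1 hb, spaceShiftH_ι hE1 ha, spaceShiftOp_add ha hb,
      LinearMap.comp_apply]

/-- **`U_s(a)` is unitary**: `⟪U_s(a) φ, U_s(a) ψ⟫ = ⟪φ, ψ⟫`. [cite: OsterwalderSchraderCMP1973, §4.1 eq. (4.5)] -/
theorem _root_.Literature.MathematicalPhysics.QuantumLattice.SchwingerFamily.OSSpace.inner_spaceShiftH_spaceShiftH (hE1 : 𝔖.IsEuclideanCovariant) {a : EuclideanSpace ℝ (Fin d)}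
    (ha : a 0 = 0) (φ ψ : OSHilbert 𝔖 hE2) :
    ⟪spaceShiftH hE2 a ha φ, spaceShiftH hE2 a ha ψ⟫_ℂ = ⟪φ, ψ⟫_ℂ := by
  refine denseRange_ι.induction_on φ ?_ fun u => ?_
  · exact isClosed_eq ((spaceShiftH hE2 a ha).continuous.inner continuous_const)
      (continuous_id.inner continuous_const)
  · refine denseRange_ι.induction_on ψ ?_ fun v => ?_
    · exact isClosed_eq (continuous_const.inner (spaceShiftH hE2 a ha).continuous)
        (continuous_const.inner continuous_id)
    · rw [spaceShiftH_ι hE1 ha, spaceShiftH_ι hE1 ha, inner_ι_ι, inner_ι_ι,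
        inner_spaceShiftOp_spaceShiftOp hE1 ha]

/-- `⟪U_s(a) φ, ψ⟫ = ⟪φ, U_s(−a) ψ⟫`. [folklore] -/
theorem _root_.Literature.MathematicalPhysics.QuantumLattice.SchwingerFamily.OSSpace.inner_spaceShiftH_left (hE1 : 𝔖.IsEuclideanCovariant) {a : EuclideanSpace ℝ (Fin d)}
    (ha : a 0 = 0) (φ ψ : OSHilbert 𝔖 hE2) :
    ⟪spaceShiftH hE2 a ha φ, ψ⟫_ℂ =
      ⟪φ, spaceShiftH hE2 (-a) (by rw [PiLp.neg_apply, ha, neg_zero]) ψ⟫_ℂ := by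
  have hna : (-a) 0 = 0 := by rw [PiLp.neg_apply, ha, neg_zero]
  have h := inner_spaceShiftH_spaceShiftH (hE2 := hE2) hE1 hna (spaceShiftH hE2 a ha φ) ψ
  rw [← spaceShiftH_add_apply hE1 hna ha, spaceShiftH_congr _ rfl (neg_add_cancel a),
    spaceShiftH_zero_apply hE1] at h
  exact h.symm

/-- **`U_s(a) Ω = Ω`**. [folklore] -/
theorem _root_.Literature.MathematicalPhysics.QuantumLattice.SchwingerFamily.OSSpace.spaceShiftH_vacuum (hE1 : 𝔖.IsEuclideanCovariant) {a : EuclideanSpace ℝ (Fin d)} (ha : a 0 = 0) :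
    spaceShiftH hE2 a ha (vacuum 𝔖 hE2) = vacuum 𝔖 hE2 := by
  rw [vacuum, spaceShiftH_ι hE1 ha, spaceShiftOp_δ_vacGen]

/-! ## The cluster property in vector form -/

/-- **E4 in vector form on the pre-Hilbert space** (Osterwalder–Schrader I (1973), (4.29)):
`⟪v, U_s(ta) w⟫ → ⟪v, δ_Ω⟫ ⟪δ_Ω, w⟫` as `t → ∞`, for finite combinations of generators
(sesquilinearity from `tendsto_genPairing_spaceShiftGen`). [cite: OsterwalderSchraderCMP1973, §4.4 eq. (4.29)] -/
theorem _root_.Literature.MathematicalPhysics.QuantumLattice.SchwingerFamily.OSSpace.tendsto_inner_spaceShiftOp (hE4 : 𝔖.HasClusterProperty) {a : EuclideanSpace ℝ (Fin d)}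
    (ha : a 0 = 0) (ha' : a ≠ 0) (v w : OSSpace 𝔖 hE2) :
    Tendsto (fun t : ℝ => ⟪v, spaceShiftOp 𝔖 hE2 (t • a) (smul_apply_zero_eq_zero ha t) w⟫_ℂ) atTop
      (𝓝 (⟪v, δ 𝔖 hE2 (vacGen d)⟫_ℂ * ⟪δ 𝔖 hE2 (vacGen d), w⟫_ℂ)) := by
  rw [← of_symm_eq v, ← of_symm_eq w]
  set v' := (of 𝔖 hE2).symm v
  set w' := (of 𝔖 hE2).symm w
  -- both sides as double sums over the supports
  have hL : ∀ t : ℝ, ⟪of 𝔖 hE2 v', spaceShiftOp 𝔖 hE2 (t • a) (smul_apply_zero_eq_zero ha t) (of 𝔖 hE2 w')⟫_ℂ =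
      ∑ p ∈ v'.support, ∑ q ∈ w'.support, conj (v' p) * w' q *
        genPairing 𝔖 p (spaceShiftGen (t • a) (smul_apply_zero_eq_zero ha t) q) := fun t => by
    rw [spaceShiftOp_of, inner_def]
    simp only [LinearEquiv.symm_apply_apply]
    conv_lhs => rw [← (Finsupp.mapDomain_id : Finsupp.mapDomain id v' = v')]
    rw [osFormFree_mapDomain]
    rfl
  have hΩr : ⟪of 𝔖 hE2 v', δ 𝔖 hE2 (vacGen d)⟫_ℂ = ∑ p ∈ v'.support, conj (v' p) * genPairing 𝔖 p (vacGen d) := by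
    rw [δ, inner_def]
    simp only [LinearEquiv.symm_apply_apply]
    rw [← (Finsupp.mapDomain_id : Finsupp.mapDomain id v' = v'),
      ← (Finsupp.mapDomain_id : Finsupp.mapDomain id (Finsupp.single (vacGen d) (1 : ℂ)) = _),
      osFormFree_mapDomain, Finsupp.mapDomain_id]
    refine Finset.sum_congr rfl fun p _ => ?_
    rw [Finsupp.support_single _ one_ne_zero, Finset.sum_singleton, Finsupp.single_eq_same,
      mul_one]
    rfl
  have hΩl : ⟪δ 𝔖 hE2 (vacGen d), of 𝔖 hE2 w'⟫_ℂ = ∑ q ∈ w'.support, w' q * genPairing 𝔖 (vacGen d) q := by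
    rw [δ, inner_def]
    simp only [LinearEquiv.symm_apply_apply]
    rw [← (Finsupp.mapDomain_id : Finsupp.mapDomain id w' = w'),
      ← (Finsupp.mapDomain_id : Finsupp.mapDomain id (Finsupp.single (vacGen d) (1 : ℂ)) = _),
      osFormFree_mapDomain, Finsupp.mapDomain_id, Finsupp.support_single _ one_ne_zero,
      Finset.sum_singleton]
    refine Finset.sum_congr rfl fun q _ => ?_
    rw [Finsupp.single_eq_same, map_one, one_mul]
    rfl
  simp only [hL]
  rw [hΩr, hΩl, Finset.sum_mul_sum]
  refine tendsto_finsetSum _ fun p _ => tendsto_finsetSum _ fun q _ => ?_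
  have h := (tendsto_genPairing_spaceShiftGen 𝔖 hE4 ha ha' p q).const_mul (conj (v' p) * w' q)
  refine h.congr' (Eventually.of_forall fun t => rfl) |>.trans ?_
  rw [show conj (v' p) * w' q * (genPairing 𝔖 p (vacGen d) * genPairing 𝔖 (vacGen d) q) =
    conj (v' p) * genPairing 𝔖 p (vacGen d) * (w' q * genPairing 𝔖 (vacGen d) q) by ring]

/-- **The cluster property E4 in vector form on the OS Hilbert space** (Osterwalder–Schrader I
(1973), §4.4, (4.29)–(4.30): "By continuity (4.29) remains true if we replace `w(f)` and `w(g)`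
by arbitrary vectors in `ℋ`"): for every nonzero spatial vector `a` and all `φ, ψ ∈ ℋ`,
`⟪φ, U_s(ta) ψ⟫ → ⟪φ, Ω⟫ ⟪Ω, ψ⟫` as `t → ∞` (E1 for `‖U_s‖ ≤ 1`, E2 for the Hilbert space,
E4). [cite: OsterwalderSchraderCMP1973, §4.4 eqs. (4.29)–(4.30)] -/
theorem _root_.Literature.MathematicalPhysics.QuantumLattice.SchwingerFamily.OSSpace.tendsto_inner_spaceShiftH (hE1 : 𝔖.IsEuclideanCovariant) (hE4 : 𝔖.HasClusterProperty)
    {a : EuclideanSpace ℝ (Fin d)} (ha : a 0 = 0) (ha' : a ≠ 0) (φ ψ : OSHilbert 𝔖 hE2) :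
    Tendsto (fun t : ℝ => ⟪φ, spaceShiftH hE2 (t • a) (smul_apply_zero_eq_zero ha t) ψ⟫_ℂ) atTop
      (𝓝 (⟪φ, vacuum 𝔖 hE2⟫_ℂ * ⟪vacuum 𝔖 hE2, ψ⟫_ℂ)) := by
  set Ω := vacuum 𝔖 hE2 with hΩ
  set U : ℝ → OSHilbert 𝔖 hE2 →L[ℂ] OSHilbert 𝔖 hE2 :=
    fun t => spaceShiftH hE2 (t • a) (smul_apply_zero_eq_zero ha t) with hU
  have hUn : ∀ t (ξ : OSHilbert 𝔖 hE2), ‖U t ξ‖ = ‖ξ‖ := fun t ξ => norm_spaceShiftH hE1 _ ξ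
  rw [Metric.tendsto_atTop]
  intro ε hε
  -- approximate `φ`, `ψ` from the dense pre-Hilbert space
  set C : ℝ := (‖φ‖ + ‖ψ‖ + 1) * (1 + ‖Ω‖ ^ 2) with hC
  have hC0 : 0 < C := by positivity
  set η : ℝ := min 1 (ε / (4 * C)) with hη
  have hη0 : 0 < η := lt_min one_pos (by positivity)
  have hη1 : η ≤ 1 := min_le_left _ _
  have hηε : η * C ≤ ε / 4 := by
    have : η ≤ ε / (4 * C) := min_le_right _ _
    calc η * C ≤ ε / (4 * C) * C := mul_le_mul_of_nonneg_right this hC0.le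
      _ = ε / 4 := by field_simp
  obtain ⟨v, hv⟩ : ∃ v : OSSpace 𝔖 hE2, ‖φ - ι 𝔖 hE2 v‖ < η := by
    obtain ⟨v, hv⟩ := denseRange_ι.exists_dist_lt φ hη0
    exact ⟨v, by rwa [← dist_eq_norm]⟩
  obtain ⟨w, hw⟩ : ∃ w : OSSpace 𝔖 hE2, ‖ψ - ι 𝔖 hE2 w‖ < η := by
    obtain ⟨w, hw⟩ := denseRange_ι.exists_dist_lt ψ hη0
    exact ⟨w, by rwa [← dist_eq_norm]⟩
  -- the limit on the pre-Hilbert space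
  have hlim := tendsto_inner_spaceShiftOp (hE2 := hE2) hE4 ha ha' v w
  rw [Metric.tendsto_atTop] at hlim
  obtain ⟨T, hT⟩ := hlim (ε / 4) (by positivity)
  refine ⟨T, fun t ht => ?_⟩
  have hT' := hT t ht
  rw [dist_eq_norm] at hT' ⊢
  -- notation
  set φ' := ι 𝔖 hE2 v with hφ'
  set ψ' := ι 𝔖 hE2 w with hψ'
  have hvw : ⟪v, spaceShiftOp 𝔖 hE2 (t • a) (smul_apply_zero_eq_zero ha t) w⟫_ℂ = ⟪φ', U t ψ'⟫_ℂ := by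
    rw [hφ', hψ', hU]
    simp only
    rw [spaceShiftH_ι hE1, inner_ι_ι]
  have hvΩ : ⟪v, δ 𝔖 hE2 (vacGen d)⟫_ℂ = ⟪φ', Ω⟫_ℂ := by rw [hφ', hΩ, vacuum, inner_ι_ι]
  have hΩw : ⟪δ 𝔖 hE2 (vacGen d), w⟫_ℂ = ⟪Ω, ψ'⟫_ℂ := by rw [hψ', hΩ, vacuum, inner_ι_ι]
  rw [hvw, hvΩ, hΩw] at hT'
  -- norms of the approximants
  have hφ'n : ‖φ'‖ ≤ ‖φ‖ + 1 := by
    have := norm_sub_norm_le φ' φ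
    rw [norm_sub_rev] at this
    linarith [hv.le.trans hη1]
  have hψn : ‖ψ'‖ ≤ ‖ψ‖ + 1 := by
    have := norm_sub_norm_le ψ' ψ
    rw [norm_sub_rev] at this
    linarith [hw.le.trans hη1]
  -- the two error terms
  have e1 : ‖⟪φ, U t ψ⟫_ℂ - ⟪φ', U t ψ'⟫_ℂ‖ ≤ η * (‖ψ‖ + (‖φ‖ + 1)) := by
    have hsplit : ⟪φ, U t ψ⟫_ℂ - ⟪φ', U t ψ'⟫_ℂ = ⟪φ - φ', U t ψ⟫_ℂ + ⟪φ', U t (ψ - ψ')⟫_ℂ := by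
      rw [inner_sub_left, map_sub, inner_sub_right]; ring
    rw [hsplit]
    refine (norm_add_le _ _).trans ?_
    have h1 : ‖⟪φ - φ', U t ψ⟫_ℂ‖ ≤ η * ‖ψ‖ := by
      refine (norm_inner_le_norm _ _).trans ?_
      rw [hUn]
      exact mul_le_mul_of_nonneg_right hv.le (norm_nonneg _)
    have h2 : ‖⟪φ', U t (ψ - ψ')⟫_ℂ‖ ≤ (‖φ‖ + 1) * η := by
      refine (norm_inner_le_norm _ _).trans ?_
      rw [hUn]
      exact mul_le_mul hφ'n hw.le (norm_nonneg _) (by positivity)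
    nlinarith
  have e2 : ‖⟪φ, Ω⟫_ℂ * ⟪Ω, ψ⟫_ℂ - ⟪φ', Ω⟫_ℂ * ⟪Ω, ψ'⟫_ℂ‖ ≤ ‖Ω‖ ^ 2 * (η * (‖ψ‖ + (‖φ‖ + 1))) := by
    have hsplit : ⟪φ, Ω⟫_ℂ * ⟪Ω, ψ⟫_ℂ - ⟪φ', Ω⟫_ℂ * ⟪Ω, ψ'⟫_ℂ =
        ⟪φ - φ', Ω⟫_ℂ * ⟪Ω, ψ⟫_ℂ + ⟪φ', Ω⟫_ℂ * ⟪Ω, ψ - ψ'⟫_ℂ := by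
      rw [inner_sub_left, inner_sub_right]; ring
    rw [hsplit]
    refine (norm_add_le _ _).trans ?_
    rw [norm_mul, norm_mul]
    have h1 : ‖⟪φ - φ', Ω⟫_ℂ‖ * ‖⟪Ω, ψ⟫_ℂ‖ ≤ (η * ‖Ω‖) * (‖Ω‖ * ‖ψ‖) :=
      mul_le_mul ((norm_inner_le_norm _ _).trans (mul_le_mul_of_nonneg_right hv.le (norm_nonneg _)))
        (norm_inner_le_norm _ _) (norm_nonneg _) (by positivity)
    have h2 : ‖⟪φ', Ω⟫_ℂ‖ * ‖⟪Ω, ψ - ψ'⟫_ℂ‖ ≤ ((‖φ‖ + 1) * ‖Ω‖) * (‖Ω‖ * η) :=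
      mul_le_mul ((norm_inner_le_norm _ _).trans (mul_le_mul_of_nonneg_right hφ'n (norm_nonneg _)))
        ((norm_inner_le_norm _ _).trans (mul_le_mul_of_nonneg_left hw.le (norm_nonneg _)))
        (by positivity) (by positivity)
    nlinarith [norm_nonneg Ω]
  -- conclusion
  have key : ‖⟪φ, U t ψ⟫_ℂ - ⟪φ, Ω⟫_ℂ * ⟪Ω, ψ⟫_ℂ‖ ≤
      ‖⟪φ, U t ψ⟫_ℂ - ⟪φ', U t ψ'⟫_ℂ‖ + ‖⟪φ', U t ψ'⟫_ℂ - ⟪φ', Ω⟫_ℂ * ⟪Ω, ψ'⟫_ℂ‖ +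
        ‖⟪φ, Ω⟫_ℂ * ⟪Ω, ψ⟫_ℂ - ⟪φ', Ω⟫_ℂ * ⟪Ω, ψ'⟫_ℂ‖ := by
    have : ⟪φ, U t ψ⟫_ℂ - ⟪φ, Ω⟫_ℂ * ⟪Ω, ψ⟫_ℂ =
        (⟪φ, U t ψ⟫_ℂ - ⟪φ', U t ψ'⟫_ℂ) + (⟪φ', U t ψ'⟫_ℂ - ⟪φ', Ω⟫_ℂ * ⟪Ω, ψ'⟫_ℂ) -
          (⟪φ, Ω⟫_ℂ * ⟪Ω, ψ⟫_ℂ - ⟪φ', Ω⟫_ℂ * ⟪Ω, ψ'⟫_ℂ) := by ring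
    rw [this]
    exact (norm_sub_le _ _).trans (add_le_add (norm_add_le _ _) le_rfl)
  have hbound : η * (‖ψ‖ + (‖φ‖ + 1)) + ‖Ω‖ ^ 2 * (η * (‖ψ‖ + (‖φ‖ + 1))) ≤ η * C := by
    rw [hC]; exact le_of_eq (by ring)
  change ‖⟪φ, U t ψ⟫_ℂ - ⟪φ, Ω⟫_ℂ * ⟪Ω, ψ⟫_ℂ‖ < ε
  linarith [e1, e2, hT'.le, key]

end OSSpace

end SchwingerFamily

end Literature.MathematicalPhysics.QuantumFieldTheory
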